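import Summits.Ventures.PercRepro.PuncturedLYM

/-!
# PercRepro — (SP) FROM A POTENTIAL: THE LEAST-SQUARES COUPLING REDUCTION (p10, gen 30; continues PuncturedLYM)

For a function `β : Y → ℚ` on the level above define the POTENTIAL WEIGHTS on the inclusion pairs `X ⊂ Y`
(`X ∈ P`, `Y ∈ Y`):

    `w_β(X, Y) = (1 + Σ_{Y′ ⊃ X, Y′ ≠ Y} (β Y − β Y′)) / (n − j)`.

* `sum_sups_potWeight` — the ROW SUMS of `w_β` are `1` for every `β` (the double sum of `β Y − β Y′` over a star is
  antisymmetric);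
* `sum_subsP_potWeight` — the COLUMN SUM at `Y` is `(d(Y) + (Lβ)(Y)) / (n − j)`, where `d(Y) = #(P ∩ 2^Y)` and
  `(Lβ)(Y) = Σ_{X ∈ P ∩ 2^Y} Σ_{Y′ ⊃ X, Y′ ≠ Y} (β Y − β Y′) = (n − j − 1) d(Y) β(Y) − Σ_{Y′ ∼ Y} β(Y′)` is the Laplacian of
  the graph on `Y` in which `Y ∼ Y′` iff `Y ∩ Y′ ∈ P` (the Johnson graph `J(n, j+1)` minus the `#D` vertex-disjoint
  `(n−j)`-cliques through the code words);
* `puncturedNMP_of_potential` — **THE REDUCTION**: if the potential weights of some `β` are nonnegative on the inclusion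
  pairs and have column sums `≤ #P / #Y` — equivalently `Lβ ≤ 1_T − τ` pointwise, with `1_T` the indicator of the touched
  sets and `τ = #T / #Y` their density — then (SP) holds for the code.  The column sums have total `#P`, so "`≤`" forces
  equality: `β` solves the Poisson equation `Lβ = 1_T − τ` and is unique up to a constant (`β = L⁺(1_T − τ)`).  This
  LEAST-SQUARES COUPLING is nonnegative with `(n − j)·w_β ≥ 0.58` on every instance tested (all codes with `n ≤ 7`, all
  codes on `8` points at every `j`, 1,800 structured and random codes with `n ≤ 14`; paper §3): (SP) is reduced to the
  gradient bound `Σ_{Y′ ⊃ X, Y′ ≠ Y} (β Y′ − β Y) ≤ 1` for the Poisson potential of the punctured Johnson graph.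
Nothing here asserts (SP).
-/

namespace PercRepro.PuncturedLYM

open Finset

variable {α : Type} [Fintype α] [DecidableEq α]

/-- The potential weights of `β`: `w_β(X, Y) = (1 + Σ_{Y′ ⊃ X, Y′ ≠ Y} (β Y − β Y′)) / (n − j)`. -/
def potWeight (j : ℕ) (β : Finset α → ℚ) (X Y : Finset α) : ℚ :=
  (1 + ∑ Y' ∈ (sups j X).erase Y, (β Y - β Y')) / ((Fintype.card α - j : ℕ) : ℚ)

omit [Fintype α] in
/-- The antisymmetric double sum over a star vanishes: `Σ_{Y ∈ S} Σ_{Y′ ∈ S ∖ {Y}} (β Y − β Y′) = 0`. -/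
theorem sum_sum_erase_sub (S : Finset (Finset α)) (β : Finset α → ℚ) :
    ∑ Y ∈ S, ∑ Y' ∈ S.erase Y, (β Y - β Y') = 0 := by
  have h1 : ∀ Y ∈ S, ∑ Y' ∈ S.erase Y, (β Y - β Y') = ∑ Y' ∈ S, (β Y - β Y') := by
    intro Y hY
    rw [← sum_erase_add _ _ hY, sub_self, add_zero]
  rw [sum_congr rfl h1]
  have h2 : ∑ Y ∈ S, ∑ Y' ∈ S, (β Y - β Y') = ∑ Y ∈ S, ∑ Y' ∈ S, β Y - ∑ Y ∈ S, ∑ Y' ∈ S, β Y' := by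
    rw [← sum_sub_distrib]
    apply sum_congr rfl
    intro Y _
    rw [sum_sub_distrib]
  have h3 : ∑ Y ∈ S, ∑ Y' ∈ S, β Y' = ∑ Y ∈ S, ∑ Y' ∈ S, β Y := sum_comm
  rw [h2, h3, sub_self]

/-- **Row sums of the potential weights are `1`** for every `β` (at a `j`-set `X` with `j < n`). -/
theorem sum_sups_potWeight {j : ℕ} {X : Finset α} (hX : X.card = j) (hjn : j < Fintype.card α)
    (β : Finset α → ℚ) : ∑ Y ∈ sups j X, potWeight j β X Y = 1 := by
  unfold potWeight
  rw [← sum_div, sum_add_distrib, sum_sum_erase_sub, add_zero, sum_const, nsmul_eq_mul, mul_one, card_sups hX]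
  have h : ((Fintype.card α - j : ℕ) : ℚ) ≠ 0 := by
    have : 0 < Fintype.card α - j := Nat.sub_pos_of_lt hjn
    exact_mod_cast this.ne'
  exact div_self h

/-- **The column sum of the potential weights is `(d(Y) + (Lβ)(Y)) / (n − j)`**, with `d(Y) = #(P ∩ 2^Y)` and
`(Lβ)(Y) = Σ_{X ∈ P ∩ 2^Y} Σ_{Y′ ⊃ X, Y′ ≠ Y} (β Y − β Y′)` the punctured-Johnson Laplacian of `β` at `Y`. -/
theorem sum_subsP_potWeight (j : ℕ) (D : Finset (Finset α)) (β : Finset α → ℚ) (Y : Finset α) :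
    ∑ X ∈ subsP j D Y, potWeight j β X Y =
      ((subsP j D Y).card + ∑ X ∈ subsP j D Y, ∑ Y' ∈ (sups j X).erase Y, (β Y - β Y')) /
        ((Fintype.card α - j : ℕ) : ℚ) := by
  unfold potWeight
  rw [← sum_div, sum_add_distrib, sum_const, nsmul_eq_mul, mul_one]

omit [DecidableEq α] in
/-- The level above is non-empty when `j < n`. -/
theorem card_levelAbove_pos {j : ℕ} (hjn : j < Fintype.card α) : 0 < (levelAbove α j).card := by
  unfold levelAbove
  rw [card_powersetCard, card_univ]
  exact Nat.choose_pos hjn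

/-- **(SP) from a potential.** If the potential weights of `β` are nonnegative on the inclusion pairs `X ∈ P`,
`Y ⊃ X` and their column sums are `≤ #P / #Y` at every `Y` (the Poisson inequality `Lβ ≤ 1_T − τ`), then (SP) holds for
the code: the row sums are `1`, so the master lemma applies with `r = #Y / #P`. -/
theorem puncturedNMP_of_potential {j : ℕ} {D : Finset (Finset α)} (hjn : j < Fintype.card α) (β : Finset α → ℚ)
    (hpos : ∀ X ∈ punctured j D, ∀ Y ∈ sups j X, 0 ≤ potWeight j β X Y)
    (hcol : ∀ Y ∈ levelAbove α j,
      ∑ X ∈ subsP j D Y, potWeight j β X Y ≤ ((punctured j D).card : ℚ) / (levelAbove α j).card) :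
    PuncturedNMP j D := by
  intro 𝒜 h𝒜
  rcases Nat.eq_zero_or_pos (punctured j D).card with hP | hP
  · -- `P = ∅`: `𝒜 = ∅`
    have : 𝒜 = ∅ := subset_empty.1 (card_eq_zero.1 hP ▸ h𝒜)
    subst this
    simp
  have hY : 0 < (levelAbove α j).card := card_levelAbove_pos hjn
  set c : ℚ := ((punctured j D).card : ℚ) / (levelAbove α j).card with hc
  have hcpos : 0 < c := by positivity
  -- the weights `w_β / c`, cut off outside the inclusion pairs
  set w : Finset α → Finset α → ℚ :=
    fun X Y => if X ∈ punctured j D ∧ Y ∈ sups j X then potWeight j β X Y / c else 0 with hw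
  have hw0 : ∀ X Y, 0 ≤ w X Y := by
    intro X Y
    simp only [hw]
    split_ifs with h
    · exact div_nonneg (hpos X h.1 Y h.2) hcpos.le
    · exact le_rfl
  have hrow : ∀ X ∈ punctured j D, 1 / c ≤ ∑ Y ∈ sups j X, w X Y := by
    intro X hX
    have : ∑ Y ∈ sups j X, w X Y = ∑ Y ∈ sups j X, potWeight j β X Y / c := by
      apply sum_congr rfl
      intro Y hY
      simp only [hw, hX, hY, and_self, if_true]
    rw [this, ← sum_div, sum_sups_potWeight (mem_punctured.1 hX).1 hjn β]
  have hcol' : ∀ Y ∈ levelAbove α j, ∑ X ∈ subsP j D Y, w X Y ≤ 1 := by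
    intro Y hY
    have : ∑ X ∈ subsP j D Y, w X Y = ∑ X ∈ subsP j D Y, potWeight j β X Y / c := by
      apply sum_congr rfl
      intro X hX
      have hX' := mem_subsP.1 hX
      have h1 : X ∈ punctured j D := mem_punctured.2 hX'.1
      have h2 : Y ∈ sups j X := mem_sups.2 ⟨mem_levelAbove.1 hY, hX'.2⟩
      simp only [hw, h1, h2, and_self, if_true]
    rw [this, ← sum_div, div_le_one hcpos]
    exact hcol Y hY
  have hmain := card_upNbhd_ge_of_weights w (1 / c) hw0 hrow hcol' h𝒜
  -- `#𝒜 / c ≤ #N(𝒜)`, i.e. `#𝒜 · #Y ≤ #N(𝒜) · #P`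
  have hq : ((𝒜.card * (levelAbove α j).card : ℕ) : ℚ) ≤ ((upNbhd j 𝒜).card * (punctured j D).card : ℕ) := by
    push_cast
    have hYq : (0 : ℚ) < (levelAbove α j).card := by exact_mod_cast hY
    have hPq : (0 : ℚ) < (punctured j D).card := by exact_mod_cast hP
    rw [hc] at hmain
    rw [one_div, inv_div, mul_div_assoc', div_le_iff₀ hPq] at hmain
    linarith
  exact_mod_cast hq

end PercRepro.PuncturedLYM
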